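import Summits.AtomisticToContinuum.HydrodynamicLimit.Theorems.ImplosionDichotomyDiluteSelfConsistencyTimeLocalisation

/-!
# `DiluteSelfConsistency` (stmt-AtomisticToContinuum-3091): the post-window clause does not depend on the ideal development

Line `birth`, lead c4 (prover-line-stmt-AtomisticToContinuum-3091-c4-0). The one open stub of the line, B.2
`stub_postWindowDilute`, asks — for every level `η`, all profiles and EVERY classical ideal-gas development of the
reference data on a nonempty `[0, T₁)` — for a window start `T₂ ∈ (0, T₁)` and a threshold below which every admissible
σ-solution is dilute on `(T₂, T)`. This file records, as theorems, the observation behind lead c4's reshape audit: for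
FIXED level and profiles the per-development clause of B.2 is EQUIVALENT to the crux's own inner clause
`∃ σ₀ > 0, DiluteSelfConsistencyHoldsAt η a₀ θ₀ u₀ σ₀` (`postWindowAt_iff_holdsAt`), whatever the development — because
the landed pre-singular piece B.1 (`diluteSelfConsistency_preSingular`) covers `[0, T₂]` for every `T₂` short of ANY
development. Consequently the clause for one development holds iff it holds for any other (`postWindowAt_iff_postWindowAt`):
the window start and the development only relocate where B.1 stops; the content of B.2 is σ-uniform packing control of the
σ-solutions over their own whole classical life, i.e. the crux at that profile — so no split of B.2 by properties of the
development (extendable / maximal / bounded on `[0, T₁)`) can isolate a provable piece.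
-/

noncomputable section

namespace Summit.AtomisticToContinuum.HydrodynamicLimit.Theorems

open MeasureTheory Filter Set Topology
open Literature.MathematicalPhysics.KineticTheory Literature.Analysis.FluidPDE Literature.Analysis.FunctionSpaces
open Summit.AtomisticToContinuum.HydrodynamicLimit.Theses.ImplosionDichotomy

/-- **The per-development post-window clause is the crux's inner clause** (registered sub-goal of stmt-3091). For a
level `η > 0`, continuous positive profiles `(a₀, θ₀, u₀)` and a classical ideal-gas development `(ρ₁, u₁, θ₁)` of the
reference data on a nonempty `[0, T₁)`: "there are `T₂ ∈ (0, T₁)` and `σ₀ > 0` such that every admissible σ-solution,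
`σ < σ₀`, is dilute at level `η` on `(T₂, T)`" holds iff "there is `σ₀ > 0` with
`DiluteSelfConsistencyHoldsAt η a₀ θ₀ u₀ σ₀`" (dilute on all of `[0, T)`). `→`: B.1 `diluteSelfConsistency_preSingular`
on `[0, T₂]` and the minimum of the two thresholds; `←`: `T₂ := T₁/2`. [cite: Kato1975, Thm III] -/
theorem postWindowAt_iff_holdsAt :
    ∀ η : ℝ, 0 < η → ∀ (a₀ θ₀ : T3 → ℝ) (u₀ : T3 → V3), Continuous a₀ → Continuous θ₀ → Continuous u₀ → (∀ x, 0
      < a₀ x) → (∀ x, 0 < θ₀ x) → ∀ (T₁ : ℝ) (ρ₁ θ₁ : ℝ → T3 → ℝ) (u₁ : ℝ → T3 → V3), 0 < T₁ →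
      IsHardSphereEulerSolution 0 T₁ ρ₁ u₁ θ₁ → (∀ x, ρ₁ 0 x = a₀ x / ∫ y, a₀ y) → u₁ 0 = u₀ → θ₁ 0 = θ₀ → ((∃ T₂
      : ℝ, 0 < T₂ ∧ T₂ < T₁ ∧ ∃ σ₀ : ℝ, 0 < σ₀ ∧ ∀ σ : ℝ, 0 < σ → σ < σ₀ → ∀ (T : ℝ) (ρ θ : ℝ → T3 → ℝ) (u : ℝ →
      T3 → V3), IsHardSphereEulerSolution σ T ρ u θ → ∀ Φ : (N : ℕ) → HardSphereFlow (Torus.geometry (Fin 3))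
      (hsDiameter σ N) (N + 1), TendstoHydroFieldsAt (fun N => localGibbsLaw σ a₀ u₀ θ₀ N (Φ N)) Φ ρ u θ 0 → ∀ t ∈
      Ico 0 T, T₂ < t → ∀ x, ρ t x * σ ^ 3 < η) ↔ ∃ σ₀ : ℝ, 0 < σ₀ ∧ DiluteSelfConsistencyHoldsAt η a₀ θ₀ u₀ σ₀) := by
  intro η hη a₀ θ₀ u₀ ha hθ hu ha0 hθ0 T₁ ρ₁ θ₁ u₁ hT₁ hsol hd hu0 hθ₀
  constructor
  · rintro ⟨T₂, hT₂, hT₂1, σ₂, hσ₂, H2⟩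
    obtain ⟨σ₁, hσ₁, H1⟩ :=
      diluteSelfConsistency_preSingular η hη a₀ θ₀ u₀ ha hθ hu ha0 hθ0 T₁ ρ₁ θ₁ u₁ hsol hd hu0 hθ₀ T₂ hT₂ hT₂1
    refine ⟨min σ₁ σ₂, lt_min hσ₁ hσ₂, ?_⟩
    intro σ hσ hσlt T ρ θ u hE Φ htie t ht x
    by_cases htT : t ≤ T₂
    · exact H1 σ hσ (lt_of_lt_of_le hσlt (min_le_left _ _)) T ρ θ u hE Φ htie t ht htT x
    · exact H2 σ hσ (lt_of_lt_of_le hσlt (min_le_right _ _)) T ρ θ u hE Φ htie t ht (lt_of_not_ge htT) x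
  · rintro ⟨σ₀, hσ₀, H⟩
    exact ⟨T₁ / 2, by linarith, by linarith, σ₀, hσ₀,
      fun σ hσ hσlt T ρ θ u hE Φ htie t ht _ x => H σ hσ hσlt T ρ θ u hE Φ htie t ht x⟩

/-- **Independence of the development** (registered sub-goal of stmt-3091). For fixed level and profiles, the
post-window clause of B.2 for one classical ideal development of the reference data holds iff it holds for any other
one (both are the crux's inner clause, `postWindowAt_iff_holdsAt`). [cite: Kato1975, Thm III] -/
theorem postWindowAt_iff_postWindowAt :
    ∀ η : ℝ, 0 < η → ∀ (a₀ θ₀ : T3 → ℝ) (u₀ : T3 → V3), Continuous a₀ → Continuous θ₀ → Continuous u₀ → (∀ x, 0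
      < a₀ x) → (∀ x, 0 < θ₀ x) → ∀ (T₁ : ℝ) (ρ₁ θ₁ : ℝ → T3 → ℝ) (u₁ : ℝ → T3 → V3), 0 < T₁ →
      IsHardSphereEulerSolution 0 T₁ ρ₁ u₁ θ₁ → (∀ x, ρ₁ 0 x = a₀ x / ∫ y, a₀ y) → u₁ 0 = u₀ → θ₁ 0 = θ₀ → ∀ (T₁'
      : ℝ) (ρ₁' θ₁' : ℝ → T3 → ℝ) (u₁' : ℝ → T3 → V3), 0 < T₁' → IsHardSphereEulerSolution 0 T₁' ρ₁' u₁' θ₁' → (∀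
      x, ρ₁' 0 x = a₀ x / ∫ y, a₀ y) → u₁' 0 = u₀ → θ₁' 0 = θ₀ → ((∃ T₂ : ℝ, 0 < T₂ ∧ T₂ < T₁ ∧ ∃ σ₀ : ℝ, 0 < σ₀ ∧
      ∀ σ : ℝ, 0 < σ → σ < σ₀ → ∀ (T : ℝ) (ρ θ : ℝ → T3 → ℝ) (u : ℝ → T3 → V3), IsHardSphereEulerSolution σ T ρ u
      θ → ∀ Φ : (N : ℕ) → HardSphereFlow (Torus.geometry (Fin 3)) (hsDiameter σ N) (N + 1), TendstoHydroFieldsAt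
      (fun N => localGibbsLaw σ a₀ u₀ θ₀ N (Φ N)) Φ ρ u θ 0 → ∀ t ∈ Ico 0 T, T₂ < t → ∀ x, ρ t x * σ ^ 3 < η) ↔ (∃
      T₂ : ℝ, 0 < T₂ ∧ T₂ < T₁' ∧ ∃ σ₀ : ℝ, 0 < σ₀ ∧ ∀ σ : ℝ, 0 < σ → σ < σ₀ → ∀ (T : ℝ) (ρ θ : ℝ → T3 → ℝ) (u : ℝ
      → T3 → V3), IsHardSphereEulerSolution σ T ρ u θ → ∀ Φ : (N : ℕ) → HardSphereFlow (Torus.geometry (Fin 3))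
      (hsDiameter σ N) (N + 1), TendstoHydroFieldsAt (fun N => localGibbsLaw σ a₀ u₀ θ₀ N (Φ N)) Φ ρ u θ 0 → ∀ t ∈
      Ico 0 T, T₂ < t → ∀ x, ρ t x * σ ^ 3 < η)) := by
  intro η hη a₀ θ₀ u₀ ha hθ hu ha0 hθ0 T₁ ρ₁ θ₁ u₁ hT₁ hsol hd hu0 hθ₀ T₁' ρ₁' θ₁' u₁' hT₁' hsol' hd' hu0' hθ₀'
  exact (postWindowAt_iff_holdsAt η hη a₀ θ₀ u₀ ha hθ hu ha0 hθ0 T₁ ρ₁ θ₁ u₁ hT₁ hsol hd hu0 hθ₀).trans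
    (postWindowAt_iff_holdsAt η hη a₀ θ₀ u₀ ha hθ hu ha0 hθ0 T₁' ρ₁' θ₁' u₁' hT₁' hsol' hd' hu0' hθ₀').symm

end Summit.AtomisticToContinuum.HydrodynamicLimit.Theorems

end
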